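import Mathlib
import HarnessLib
import Literature.MathematicalPhysics.QuantumLattice.GaugeGroups
import Summits.Ventures.LatticeQCDFlow.Exactness.ComplexRealification
import Summits.Ventures.LatticeQCDFlow.Exactness.SphereOrbitLaw

/-!
# `SU(N)` acting on the unit sphere of `ℂ^N ≅ ℝ^{2N}` by real linear isometries; the orbit map

HONEST FRAMING: exact (Metropolis-corrected) sampling algorithms for lattice gauge theory;
figures of merit are autocorrelation/cost numbers at stated couplings and volumes; no
continuum-physics claim.

Venture `LatticeQCDFlow` (cell pub-lqcd), topic `Exactness`, FANOUT row 9 (eng-latcore, the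
engine `latflow.core`: `update_link` in `csrc/latcore_template.c` runs, for `N ≥ 3`, one
Cabibbo–Marinari heat-bath hit per coordinate pair `(i, j)`, `i < j`, lexicographically).  NEW WORK
of the cell over Mathlib and row 9's earlier files; nothing is cited as a fact.  Part of the
groundwork of the ergodicity proof for the SU(N) heat bath (`CabibboMarinariKernel.lean` and
`HeatBathSweepErgodic.lean` list "SU(N ≥ 3) Cabibbo–Marinari ergodicity" as NOT CLAIMED: one
subgroup hit does not dominate a Haar refresh).  The plan: the convolution of the embedded SU(2)
Haar measures over the lexicographic pairs dominates a multiple of Haar on `SU(N)` (induction over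
coordinate subgroups through their orbit laws on spheres), hence the link update is Doeblin.
Uses `ComplexRealification.lean` (`realify`/`complexify`) and `SphereOrbitLaw.lean` (`norm_toLp_sq`).

## What is proved (`n` a finite index type, `E n = EuclideanSpace ℝ (n ⊕ n)`, `S n` its unit sphere)

* §1 `cplx`/`rvec` — complex coordinates of a real vector and back (additive, real-homogeneous,
  continuous); `norm_rvec_sq` (`‖rvec z‖² = Σ ‖zᵢ‖²`); `star_dotProduct_mulVec_unitary` / `norm_rvec_mulVec_unitary`
  (a unitary matrix preserves `z† z` and the Euclidean length); **`rotC A hA : E n ≃ₗᵢ[ℝ] E n`** — a unitary matrix acting on `ℝ^{2N}`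
  as a real linear isometry; `rotC_mul`; **`actSU g : S n → S n`** — the action of `SU(N)` on
  `S^{2N−1}`; `actSU_mul/_one`; jointly continuous (`continuous_actSU`), measurable in each variable.
* §2 `spt`, **`bpt i`** — a complex unit vector / the basis vector `e_i` as a point of the sphere;
  **`orbMap i g = g • e_i`** (continuous, measurable, `orbMap_mul`); `cplx_orbMap` (its complex
  coordinates are column `i` of `g`).

NOT CLAIMED here: anything measure-theoretic (orbit laws, Haar) — later files.
-/

namespace Summit.Ventures.LatticeQCDFlow.Exactness

open Matrix MeasureTheory WithLp Metric Complex

variable {n : Type*} [Fintype n] [DecidableEq n]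

/-- The real coordinate space `ℝ^{n ⊕ n} ≅ ℂ^n` with its Euclidean norm. -/
abbrev E (n : Type*) [Fintype n] := EuclideanSpace ℝ (n ⊕ n)

/-- Its unit sphere `S^{2N−1}`. -/
abbrev S (n : Type*) [Fintype n] := sphere (0 : E n) 1

/-! ## §1 Unitary matrices act on `ℝ^{2N}` by linear isometries -/

section Action

/-- Complex coordinates of a real vector. -/
def cplx (x : E n) : n → ℂ := complexify (ofLp x)

/-- The real vector with given complex coordinates. -/
def rvec (z : n → ℂ) : E n := toLp 2 (realify z)

omit [DecidableEq n] in
/-- `cplx ∘ rvec = id`. -/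
@[simp] theorem cplx_rvec (z : n → ℂ) : cplx (rvec z) = z := by
  simp [cplx, rvec]

omit [DecidableEq n] in
/-- `rvec ∘ cplx = id`. -/
@[simp] theorem rvec_cplx (x : E n) : rvec (cplx x) = x := by
  simp [cplx, rvec]

omit [DecidableEq n] in
/-- `rvec` is additive. -/
theorem rvec_add (z w : n → ℂ) : rvec (z + w) = rvec z + rvec w := by
  change toLp 2 (realifyLin (z + w)) = toLp 2 (realifyLin z) + toLp 2 (realifyLin w)
  rw [map_add]; rfl

omit [DecidableEq n] in
/-- `rvec` commutes with real scalars. -/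
theorem rvec_smul (c : ℝ) (z : n → ℂ) : rvec (c • z) = c • rvec z := by
  change toLp 2 (realifyLin (c • z)) = c • toLp 2 (realifyLin z)
  rw [map_smul]; rfl

omit [DecidableEq n] in
/-- `cplx` is additive. -/
theorem cplx_add (x y : E n) : cplx (x + y) = cplx x + cplx y := by
  change realifyLin.symm (ofLp (x + y)) = realifyLin.symm (ofLp x) + realifyLin.symm (ofLp y)
  rw [ofLp_add, map_add]

omit [DecidableEq n] in
/-- `cplx` commutes with real scalars. -/
theorem cplx_smul (c : ℝ) (x : E n) : cplx (c • x) = c • cplx x := by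
  change realifyLin.symm (ofLp (c • x)) = c • realifyLin.symm (ofLp x)
  rw [ofLp_smul, map_smul]

omit [DecidableEq n] in
/-- **`‖rvec z‖² = Σ ‖zᵢ‖²`.** -/
theorem norm_rvec_sq (z : n → ℂ) : ‖rvec z‖ ^ 2 = ∑ i, ‖z i‖ ^ 2 := by
  rw [rvec, norm_toLp_sq, realify_dotProduct_self]

/-- **A unitary matrix preserves the Hermitian form**: `(A z)† (A z) = z† z`. -/
theorem star_dotProduct_mulVec_unitary {A : Matrix n n ℂ} (hA : A ∈ Matrix.unitaryGroup n ℂ)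
    (z : n → ℂ) : star (A *ᵥ z) ⬝ᵥ (A *ᵥ z) = star z ⬝ᵥ z := by
  rw [star_mulVec, ← dotProduct_mulVec, mulVec_mulVec, ← Matrix.star_eq_conjTranspose,
    Matrix.mem_unitaryGroup_iff'.1 hA, one_mulVec]

/-- … hence the Euclidean length of the realification: `‖rvec (A z)‖ = ‖rvec z‖`
(the sums of squared moduli `Σ ‖(A z)ᵢ‖² = Re (A z)†(A z)` agree). -/
theorem norm_rvec_mulVec_unitary {A : Matrix n n ℂ} (hA : A ∈ Matrix.unitaryGroup n ℂ)
    (z : n → ℂ) : ‖rvec (A *ᵥ z)‖ = ‖rvec z‖ := by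
  have hre : ∀ w : n → ℂ, ∑ i, ‖w i‖ ^ 2 = (star w ⬝ᵥ w).re := fun w => by
    rw [dotProduct, Complex.re_sum]
    refine Finset.sum_congr rfl fun i _ => ?_
    rw [Pi.star_apply, Complex.star_def, Complex.sq_norm, ← Complex.normSq_eq_conj_mul_self]
    simp
  have h : ‖rvec (A *ᵥ z)‖ ^ 2 = ‖rvec z‖ ^ 2 := by
    rw [norm_rvec_sq, norm_rvec_sq, hre, hre, star_dotProduct_mulVec_unitary hA]
  exact (pow_left_inj₀ (norm_nonneg _) (norm_nonneg _) two_ne_zero).1 h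

/-- The action `x ↦ rvec (A · cplx x)` as a real-linear map. -/
noncomputable def rotLin (A : Matrix n n ℂ) : E n →ₗ[ℝ] E n where
  toFun x := rvec (A *ᵥ cplx x)
  map_add' x y := by rw [cplx_add, mulVec_add, rvec_add]
  map_smul' c x := by rw [cplx_smul, mulVec_smul, rvec_smul, RingHom.id_apply]

/-- For unitary `A` the action preserves the Euclidean norm. -/
theorem norm_rotLin {A : Matrix n n ℂ} (hA : A ∈ Matrix.unitaryGroup n ℂ) (x : E n) :
    ‖rotLin A x‖ = ‖x‖ := by
  change ‖rvec (A *ᵥ cplx x)‖ = ‖x‖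
  rw [norm_rvec_mulVec_unitary hA, rvec_cplx]

/-- **A unitary matrix as a linear isometry of `ℝ^{2N}`.** -/
noncomputable def rotC (A : Matrix n n ℂ) (hA : A ∈ Matrix.unitaryGroup n ℂ) : E n ≃ₗᵢ[ℝ] E n :=
  (LinearIsometry.mk (rotLin A) (norm_rotLin hA)).toLinearIsometryEquiv rfl

/-- Pointwise formula. -/
theorem rotC_apply {A : Matrix n n ℂ} (hA : A ∈ Matrix.unitaryGroup n ℂ) (x : E n) :
    rotC A hA x = rvec (A *ᵥ cplx x) := by
  rw [rotC, LinearIsometry.coe_toLinearIsometryEquiv]; rfl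

/-- In complex coordinates the action is `mulVec`. -/
@[simp] theorem cplx_rotC {A : Matrix n n ℂ} (hA : A ∈ Matrix.unitaryGroup n ℂ) (x : E n) :
    cplx (rotC A hA x) = A *ᵥ cplx x := by
  rw [rotC_apply, cplx_rvec]

/-- The action is multiplicative. -/
theorem rotC_mul {A B : Matrix n n ℂ} (hA : A ∈ Matrix.unitaryGroup n ℂ)
    (hB : B ∈ Matrix.unitaryGroup n ℂ) (hAB : A * B ∈ Matrix.unitaryGroup n ℂ) (x : E n) :
    rotC (A * B) hAB x = rotC A hA (rotC B hB x) := by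
  rw [rotC_apply, rotC_apply, cplx_rotC, mulVec_mulVec]

/-- **The action of `g ∈ SU(N)` on the unit sphere `S^{2N−1}`.** -/
noncomputable def actSU (g : Matrix.specialUnitaryGroup n ℂ) (s : S n) : S n :=
  ⟨rotC (g : Matrix n n ℂ) (Matrix.specialUnitaryGroup_le_unitaryGroup g.2) s, by
    rw [mem_sphere_zero_iff_norm, LinearIsometryEquiv.norm_map, norm_eq_of_mem_sphere s]⟩

/-- Coordinates of the action. -/
@[simp] theorem coe_actSU (g : Matrix.specialUnitaryGroup n ℂ) (s : S n) :
    (actSU g s : E n) = rotC (g : Matrix n n ℂ) (Matrix.specialUnitaryGroup_le_unitaryGroup g.2) s := rfl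

/-- Complex coordinates of the action. -/
@[simp] theorem cplx_actSU (g : Matrix.specialUnitaryGroup n ℂ) (s : S n) :
    cplx (actSU g s : E n) = (g : Matrix n n ℂ) *ᵥ cplx (s : E n) := by
  rw [coe_actSU, cplx_rotC]

omit [DecidableEq n] in
/-- Two points of `E n` with the same complex coordinates are equal. -/
theorem cplx_injective : Function.Injective (cplx : E n → n → ℂ) := fun x y h => by
  rw [← rvec_cplx x, ← rvec_cplx y, h]

/-- The action is a group action: `(g h) • s = g • (h • s)`. -/
theorem actSU_mul (g h : Matrix.specialUnitaryGroup n ℂ) (s : S n) :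
    actSU (g * h) s = actSU g (actSU h s) := by
  apply Subtype.ext
  apply cplx_injective
  simp [← mulVec_mulVec]

/-- The identity acts trivially. -/
@[simp] theorem actSU_one (s : S n) : actSU (1 : Matrix.specialUnitaryGroup n ℂ) s = s := by
  apply Subtype.ext
  apply cplx_injective
  simp

omit [DecidableEq n] in
/-- `rvec` is continuous. -/
theorem continuous_rvec : Continuous (rvec : (n → ℂ) → E n) :=
  (PiLp.continuous_toLp 2 _).comp (realifyLin (n := n)).toLinearMap.continuous_of_finiteDimensional

omit [DecidableEq n] in
/-- `cplx` is continuous. -/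
theorem continuous_cplx : Continuous (cplx : E n → n → ℂ) :=
  (realifyLin (n := n)).symm.toLinearMap.continuous_of_finiteDimensional.comp (PiLp.continuous_ofLp 2 _)

/-- The action is jointly continuous. -/
theorem continuous_actSU : Continuous fun p : Matrix.specialUnitaryGroup n ℂ × S n => actSU p.1 p.2 := by
  have h : Continuous fun p : Matrix.specialUnitaryGroup n ℂ × S n =>
      rvec ((p.1 : Matrix n n ℂ) *ᵥ cplx (p.2 : E n)) :=
    continuous_rvec.comp ((continuous_subtype_val.comp continuous_fst).matrix_mulVec
      (continuous_cplx.comp (continuous_subtype_val.comp continuous_snd)))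
  rw [Topology.IsInducing.subtypeVal.continuous_iff]
  have heq : ((↑) : S n → E n) ∘ (fun p : Matrix.specialUnitaryGroup n ℂ × S n => actSU p.1 p.2) =
      fun p => rvec ((p.1 : Matrix n n ℂ) *ᵥ cplx (p.2 : E n)) := by
    funext p
    change (actSU p.1 p.2 : E n) = _
    rw [coe_actSU, rotC_apply]
  rw [heq]
  exact h

/-- For fixed `s`, `g ↦ g • s` is measurable. -/
theorem measurable_actSU_left (s : S n) :
    Measurable fun g : Matrix.specialUnitaryGroup n ℂ => actSU g s :=
  (continuous_actSU.comp (Continuous.prodMk_left s)).measurable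

/-- For fixed `g`, `s ↦ g • s` is measurable. -/
theorem measurable_actSU_right (g : Matrix.specialUnitaryGroup n ℂ) :
    Measurable fun s : S n => actSU g s :=
  (continuous_actSU.comp (Continuous.prodMk_right g)).measurable

/-- For fixed `s`, `g ↦ g • s` is continuous.  (Proof written bottom-up: propagating the
expected type into `Continuous.comp` makes the unifier unfold `actSU`.) -/
theorem continuous_actSU_left (s : S n) :
    Continuous fun g : Matrix.specialUnitaryGroup n ℂ => actSU g s := by
  have h := continuous_actSU.comp (Continuous.prodMk_left s)
  exact h

end Action

/-! ## §2 Basis points and the orbit map -/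

section Orbit

omit [DecidableEq n] in
/-- A complex vector with `Σ ‖zᵢ‖² = 1` gives a point of the unit sphere. -/
theorem rvec_mem_sphere {z : n → ℂ} (hz : ∑ i, ‖z i‖ ^ 2 = 1) : rvec z ∈ S n := by
  rw [mem_sphere_zero_iff_norm]
  have h := norm_rvec_sq z
  rw [hz] at h
  exact (pow_left_inj₀ (norm_nonneg _) zero_le_one two_ne_zero).1 (h.trans (one_pow 2).symm)

omit [DecidableEq n] in
/-- Conversely a point of the unit sphere has `Σ ‖zᵢ‖² = 1`. -/
theorem sum_norm_sq_cplx (s : S n) : ∑ i, ‖cplx (s : E n) i‖ ^ 2 = 1 := by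
  rw [← norm_rvec_sq, rvec_cplx, norm_eq_of_mem_sphere s, one_pow]

/-- The unit sphere point of a complex unit vector. -/
def spt (z : n → ℂ) (hz : ∑ i, ‖z i‖ ^ 2 = 1) : S n := ⟨rvec z, rvec_mem_sphere hz⟩

omit [DecidableEq n] in
/-- Its complex coordinates. -/
@[simp] theorem cplx_spt (z : n → ℂ) (hz : ∑ i, ‖z i‖ ^ 2 = 1) : cplx (spt z hz : E n) = z := by
  simp [spt]

/-- The basis vector `e_i` has unit length. -/
theorem sum_norm_sq_single (i : n) : ∑ a, ‖(Pi.single i (1 : ℂ) : n → ℂ) a‖ ^ 2 = 1 := by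
  rw [Finset.sum_eq_single i]
  · simp
  · intro a _ ha; simp [Pi.single_eq_of_ne ha]
  · intro h; exact absurd (Finset.mem_univ i) h

/-- **The basis point `e_i` of the sphere.** -/
def bpt (i : n) : S n := spt (Pi.single i 1) (sum_norm_sq_single i)

/-- Its complex coordinates. -/
@[simp] theorem cplx_bpt (i : n) : cplx (bpt i : E n) = Pi.single i 1 := cplx_spt _ _

/-- **The orbit map** `g ↦ g • e_i`. -/
noncomputable def orbMap (i : n) (g : Matrix.specialUnitaryGroup n ℂ) : S n := actSU g (bpt i)

/-- `M e_i` is column `i` of `M`. -/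
theorem mulVec_single_one (M : Matrix n n ℂ) (i : n) : M *ᵥ Pi.single i 1 = fun a => M a i := by
  funext a
  simp [Matrix.mulVec, dotProduct, Pi.single_apply]

/-- **The complex coordinates of `g • e_i` are column `i` of `g`.** -/
@[simp] theorem cplx_orbMap (i : n) (g : Matrix.specialUnitaryGroup n ℂ) :
    cplx (orbMap i g : E n) = fun a => (g : Matrix n n ℂ) a i := by
  rw [orbMap, cplx_actSU, cplx_bpt, mulVec_single_one]

/-- The orbit map is continuous … -/
theorem continuous_orbMap (i : n) : Continuous (orbMap (n := n) i) :=
  continuous_actSU_left (bpt i)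

/-- … and measurable. -/
theorem measurable_orbMap (i : n) : Measurable (orbMap (n := n) i) := (continuous_orbMap i).measurable

/-- Equivariance: `(g h) • e_i = g • (h • e_i)`. -/
theorem orbMap_mul (i : n) (g h : Matrix.specialUnitaryGroup n ℂ) :
    orbMap i (g * h) = actSU g (orbMap i h) := actSU_mul g h (bpt i)

end Orbit

end Summit.Ventures.LatticeQCDFlow.Exactness
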